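import Summits.HubbardSuperconductivity.HubbardLadder.ClusterCutSpan
import HarnessLib

/-!
# Cluster pair-cuts, piece [C](c): the block-entry builder, row checks of literal block data, and the fast `Xint` row

HONEST FRAMING: ladder R1–R4 with certified numbers; no claim on H/H₀.  Cell pub-hubbard, lane r2-eng-1 (g12); design memo
`pub-hubbard-r2-eng-1/psdcert-g12/C-SPEC-g12.md`.  Infrastructure; it certifies no cell by itself.  FILE SPLIT (400-line rule; FILER
lit g35): this is the second half of the staged `psdcert-g12/lean-staged/ClusterCutFrames.lean` 97861d910070da5c (425 l.) — §4 sparse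
columns as vectors on configurations, the block-entry builder and its correctness ([C](c3) core); §5 row checks of literal block data
against the builder (one kernel declaration per row band in the per-cut files); §6 the sparse `Xint` row of one configuration (the fast
builder).  §1–§3 (sparse integer vectors, signed orbit sums, the SPAN check `spanOK` / `spanOK_spec`) are in `ClusterCutSpan.lean`,
which this file imports; the bodies of both files are byte-identical to the staged master, only the headers / import / namespace
lines were added.  All statements [folklore].
-/

namespace Summit.HubbardSuperconductivity.HubbardLadder.ClusterCut

/-! ## §4 Sparse columns as vectors on configurations; the block-entry builder and its correctness ([C](c3) core) -/

section Builder

open Matrix Finset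

variable {N : ℕ}

/-- `encodeBits` is the value of Mathlib's `finFunctionFinEquiv`. [folklore] -/
theorem encodeBits_eq (σ : Fin N → Fin 2) : encodeBits σ = ((finFunctionFinEquiv σ : Fin (2 ^ N)) : ℕ) := by
  rw [finFunctionFinEquiv_apply]; rfl

/-- `encodeBits σ < 2^N`. [folklore] -/
theorem encodeBits_lt (σ : Fin N → Fin 2) : encodeBits σ < 2 ^ N := by
  rw [encodeBits_eq]; exact (finFunctionFinEquiv σ).isLt

/-- `decodeBits` is the inverse of `finFunctionFinEquiv` on `[0, 2^N)`. [folklore] -/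
theorem decodeBits_eq_symm (a : Fin (2 ^ N)) : decodeBits N a = finFunctionFinEquiv.symm a := by
  funext i
  apply Fin.ext
  rw [finFunctionFinEquiv_symm_apply_val, decodeBits_apply, Nat.testBit_eq_decide_div_mod_eq]
  by_cases h : (a : ℕ) / 2 ^ (i : ℕ) % 2 = 1
  · simp [h]
  · have h0 : (a : ℕ) / 2 ^ (i : ℕ) % 2 = 0 := by omega
    simp [h0]

/-- `decodeBits N (encodeBits σ) = σ`. [folklore] -/
theorem decodeBits_encodeBits (σ : Fin N → Fin 2) : decodeBits N (encodeBits σ) = σ := by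
  rw [encodeBits_eq, decodeBits_eq_symm, Equiv.symm_apply_apply]

/-- A sparse column read as a vector on configurations. [folklore] -/
def colVec (N : ℕ) (col : SVec) : (Fin N → Fin 2) → ℂ := fun σ => ((evalSV col (encodeBits σ) : ℤ) : ℂ)

/-- All keys of a sparse vector are `< 2^N`. [folklore] -/
def keysLT (N : ℕ) (col : SVec) : Bool := col.all fun e => decide (e.1 < 2 ^ N)

/-- Contraction of a bitmask-indexed sum against a sparse vector with keys `< 2^N`. [folklore] -/
theorem sum_range_mul_evalSV (g : ℕ → ℂ) :
    ∀ col : SVec, keysLT N col = true →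
      ∑ b ∈ range (2 ^ N), g b * ((evalSV col b : ℤ) : ℂ) = (col.map fun e => (e.2 : ℂ) * g e.1).sum := by
  intro col
  induction col with
  | nil => intro _; simp [evalSV]
  | cons e v ih =>
    intro hk
    obtain ⟨τ, c⟩ := e
    simp only [keysLT, List.all_cons, Bool.and_eq_true, decide_eq_true_eq] at hk
    have ih' := ih (by simpa [keysLT] using hk.2)
    simp only [evalSV, Int.cast_add, Int.cast_ite, Int.cast_zero, mul_add, Finset.sum_add_distrib, List.map_cons,
      List.sum_cons]
    rw [ih']
    congr 1
    rw [show (∑ b ∈ range (2 ^ N), g b * (if τ = b then (c : ℂ) else 0)) =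
        ∑ b ∈ range (2 ^ N), (if τ = b then g b * (c : ℂ) else 0) from
      Finset.sum_congr rfl fun b _ => by split_ifs <;> simp, Finset.sum_ite_eq, if_pos (Finset.mem_range.mpr hk.1)]
    ring

/-- **Sparse contraction**: a sum over all configurations against a sparse column collapses to the column's entries. [folklore] -/
theorem sum_mul_colVec (g : ℕ → ℂ) (col : SVec) (hk : keysLT N col = true) :
    ∑ σ : Fin N → Fin 2, g (encodeBits σ) * colVec N col σ = (col.map fun e => (e.2 : ℂ) * g e.1).sum := by
  have h1 : ∑ σ : Fin N → Fin 2, g (encodeBits σ) * colVec N col σ =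
      ∑ a : Fin (2 ^ N), g a * ((evalSV col a : ℤ) : ℂ) := by
    rw [← Equiv.sum_comp finFunctionFinEquiv.symm]
    refine Finset.sum_congr rfl fun a _ => ?_
    simp only [colVec, encodeBits_eq, Equiv.apply_symm_apply]
  rw [h1, Fin.sum_univ_eq_sum_range (fun b => g b * ((evalSV col b : ℤ) : ℂ)), sum_range_mul_evalSV g col hk]

/-- **Block entry from ONE representative** (kernel-side): `Σ_{(τ, c) ∈ col} c · xint4Bits P rep τ`. [folklore] -/
def bmatEntry (P : NatPairList) (rep : ℕ) (col : SVec) : ℤ :=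
  (col.map fun e => e.2 * xint4Bits P rep e.1).sum

/-- `bmatEntry` through the flip rule: `= 4 · Σ_{(τ,c) ∈ col} c · X_P(decode rep, decode τ)`. [folklore] -/
theorem bmatEntry_cast (P : NatPairList) (hN : 0 < N) (hP : pairsOK N P = true) {rep : ℕ} (hrep : rep < 2 ^ N) :
    ∀ (col : SVec), keysLT N col = true →
      ((bmatEntry P rep col : ℤ) : ℂ) =
        4 * (col.map fun e => (e.2 : ℂ) * pairOp (toPairList N P hN) (decodeBits N rep) (decodeBits N e.1)).sum := by
  intro col
  induction col with
  | nil => intro _; simp [bmatEntry]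
  | cons e v ih =>
    intro hk
    obtain ⟨τ, c⟩ := e
    simp only [keysLT, List.all_cons, Bool.and_eq_true, decide_eq_true_eq] at hk
    have ih' := ih (by simpa [keysLT] using hk.2)
    simp only [bmatEntry, List.map_cons, List.sum_cons, Int.cast_add, Int.cast_mul] at ih' ⊢
    rw [ih', xint4Bits_eq_pairOp P hN hP hrep hk.1]
    ring

/-- **Correctness of the block-entry builder**: `bmatEntry P rep col = 4 · (X_P · colVec col)(decode rep)`.  Combined with
`blockEntry_eq` (frame column `a • P e_rep`, `colVec col` in the range of the projector), this is the `(rep, col)` entry of `Φᴴ(4X)Φ`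
up to the frame scaling. [folklore] -/
theorem bmatEntry_eq (P : NatPairList) (hN : 0 < N) (hP : pairsOK N P = true) {rep : ℕ} (hrep : rep < 2 ^ N)
    (col : SVec) (hk : keysLT N col = true) :
    ((bmatEntry P rep col : ℤ) : ℂ) =
      4 * (pairOp (toPairList N P hN) *ᵥ colVec N col) (decodeBits N rep) := by
  rw [bmatEntry_cast P hN hP hrep col hk, Matrix.mulVec, dotProduct]
  congr 1
  have key := sum_mul_colVec (N := N) (fun b => pairOp (toPairList N P hN) (decodeBits N rep) (decodeBits N b)) col hk
  simp only [decodeBits_encodeBits] at key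
  exact key.symm

/-- **Gram entry from ONE representative** (kernel-side): the column's coefficient at `rep`. [folklore] -/
def gmatEntry (rep : ℕ) (col : SVec) : ℤ := evalSV col rep

/-- `gmatEntry rep col = (colVec col)(decode rep)` for `rep < 2^N`. [folklore] -/
theorem gmatEntry_eq {rep : ℕ} (hrep : rep < 2 ^ N) (col : SVec) :
    ((gmatEntry rep col : ℤ) : ℂ) = colVec N col (decodeBits N rep) := by
  simp only [gmatEntry, colVec]
  congr 2
  have : encodeBits (decodeBits N rep) = rep := by
    have h := decodeBits_eq_symm (N := N) ⟨rep, hrep⟩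
    simp only at h
    rw [h, encodeBits_eq, Equiv.apply_symm_apply]
  rw [this]

end Builder

/-! ## §5 Row checks of literal block data against the builder (one kernel declaration per row band in the per-cut files) -/

section RowChecks

variable {N : ℕ}

/-- Pointwise agreement of two lists through a Boolean test (lengths must agree). [folklore] -/
def allPairs (f : ℤ → SVec → Bool) : List ℤ → List SVec → Bool
  | [], [] => true
  | b :: bs, c :: cs => f b c && allPairs f bs cs
  | _, _ => false

/-- Semantics of `allPairs`. [folklore] -/
theorem allPairs_spec (f : ℤ → SVec → Bool) :
    ∀ (row : List ℤ) (cols : List SVec), allPairs f row cols = true →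
      row.length = cols.length ∧ ∀ l < cols.length, f (row.getD l 0) (cols.getD l []) = true := by
  intro row
  induction row with
  | nil =>
    intro cols h
    cases cols with
    | nil => exact ⟨rfl, fun l hl => absurd hl (Nat.not_lt_zero _)⟩
    | cons _ _ => simp [allPairs] at h
  | cons b bs ih =>
    intro cols h
    cases cols with
    | nil => simp [allPairs] at h
    | cons c cs =>
      simp only [allPairs, Bool.and_eq_true] at h
      obtain ⟨hlen, hrest⟩ := ih cs h.2
      refine ⟨by simp [hlen], fun l hl => ?_⟩
      cases l with
      | zero => simpa using h.1
      | succ l =>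
        simp only [List.getD_cons_succ]
        exact hrest l (by simpa using hl)

/-- **Row check for the `X`-block**: the literal row equals `bmatEntry P rep ·` column by column. [folklore] -/
def bmatRowOK (P : NatPairList) (rep : ℕ) (cols : List SVec) (row : List ℤ) : Bool :=
  allPairs (fun b col => decide (b = bmatEntry P rep col)) row cols

/-- Semantics of `bmatRowOK`. [folklore] -/
theorem bmatRowOK_spec {P : NatPairList} {rep : ℕ} {cols : List SVec} {row : List ℤ} (h : bmatRowOK P rep cols row = true) :
    row.length = cols.length ∧ ∀ l < cols.length, row.getD l 0 = bmatEntry P rep (cols.getD l []) := by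
  obtain ⟨hlen, hall⟩ := allPairs_spec _ row cols h
  exact ⟨hlen, fun l hl => by simpa using hall l hl⟩

/-- **Row check for the Gram block**: the literal row equals `gmatEntry rep ·` column by column. [folklore] -/
def gmatRowOK (rep : ℕ) (cols : List SVec) (row : List ℤ) : Bool :=
  allPairs (fun b col => decide (b = gmatEntry rep col)) row cols

/-- Semantics of `gmatRowOK`. [folklore] -/
theorem gmatRowOK_spec {rep : ℕ} {cols : List SVec} {row : List ℤ} (h : gmatRowOK rep cols row = true) :
    row.length = cols.length ∧ ∀ l < cols.length, row.getD l 0 = gmatEntry rep (cols.getD l []) := by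
  obtain ⟨hlen, hall⟩ := allPairs_spec _ row cols h
  exact ⟨hlen, fun l hl => by simpa using hall l hl⟩

end RowChecks

/-! ## §6 The sparse `Xint` row of one configuration (the fast builder) -/

section FastRow

variable {N : ℕ}

/-- Term list of the `Xint` row of configuration `b`: the diagonal `(b, ±w)` per pair and, for each pair with differing bits,
the exchange neighbour `(flipPairBits b i j, 2w)`. [folklore] -/
def xrowTerms (P : NatPairList) (b : ℕ) : SVec :=
  P.foldr (fun p acc =>
    (b, if b.testBit p.1 == b.testBit p.2.1 then p.2.2 else -p.2.2) ::
      (if b.testBit p.1 != b.testBit p.2.1 then (flipPairBits b p.1 p.2.1, 2 * p.2.2) :: acc else acc)) []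

/-- The `Xint` row of configuration `b` as a normalised sparse vector. [folklore] -/
def xrowVec (P : NatPairList) (b : ℕ) : SVec := normalizeSV (xrowTerms P b)

/-- Toggling two distinct bits changes the number. [folklore] -/
theorem flipPairBits_ne {i j : ℕ} (hij : i ≠ j) (b : ℕ) : flipPairBits b i j ≠ b := by
  intro h
  have := congrArg (fun n => n.testBit i) h
  simp only [testBit_flipPairBits hij, true_or, if_true] at this
  cases hb : b.testBit i <;> simp_all

/-- **The sparse row evaluates to the flip rule**: `evalSV (xrowVec P b) τ = xint4Bits P b τ` (pairs with distinct sites). [folklore] -/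
theorem evalSV_xrowVec (P : NatPairList) (hP : ∀ p ∈ P, p.1 ≠ p.2.1) (b τ : ℕ) :
    evalSV (xrowVec P b) τ = xint4Bits P b τ := by
  rw [xrowVec, evalSV_normalizeSV]
  induction P with
  | nil => simp [xrowTerms, xint4Bits, evalSV]
  | cons p ps ih =>
    have hp : p.1 ≠ p.2.1 := hP p (by simp)
    have ih' := ih (fun q hq => hP q (by simp [hq]))
    simp only [xrowTerms, List.foldr_cons, xint4Bits, List.map_cons, List.sum_cons] at ih' ⊢
    rw [← ih']
    -- the head pair's two (or one) terms against `w * pairEntry4Bits`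
    unfold pairEntry4Bits
    by_cases hd : b.testBit p.1 = b.testBit p.2.1
    · -- equal bits: only the diagonal term
      have hb : (b.testBit p.1 != b.testBit p.2.1) = false := by simp [hd]
      have hb' : (b.testBit p.1 == b.testBit p.2.1) = true := by simp [hd]
      simp only [hb', hb, if_true, evalSV, Bool.false_and]
      by_cases hbt : b = τ
      · subst hbt; simp
      · simp [hbt]
    · have hb : (b.testBit p.1 != b.testBit p.2.1) = true := by simpa using hd
      have hb' : (b.testBit p.1 == b.testBit p.2.1) = false := by simpa using hd
      simp only [hb', hb, if_true, evalSV, Bool.true_and]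
      by_cases hbt : b = τ
      · subst hbt
        have hne : flipPairBits b p.1 p.2.1 ≠ b := flipPairBits_ne hp b
        simp [hne]
      · rw [if_neg hbt, if_neg hbt]
        by_cases hft : flipPairBits b p.1 p.2.1 = τ
        · subst hft; simp [mul_comm]
        · have : ¬ (τ = flipPairBits b p.1 p.2.1) := fun h => hft h.symm
          simp [hft, this]

/-- **Fast block entry**: `Σ_{(τ,c) ∈ col} c · (xrowVec P rep)(τ)` — one sparse row per representative, `|col|·|row|` steps per entry. [folklore] -/
def bmatEntryFast (P : NatPairList) (rep : ℕ) (col : SVec) : ℤ :=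
  let row := xrowVec P rep
  (col.map fun e => e.2 * evalSV row e.1).sum

/-- `bmatEntryFast = bmatEntry` (pairs with distinct sites). [folklore] -/
theorem bmatEntryFast_eq (P : NatPairList) (hP : ∀ p ∈ P, p.1 ≠ p.2.1) (rep : ℕ) (col : SVec) :
    bmatEntryFast P rep col = bmatEntry P rep col := by
  simp only [bmatEntryFast, bmatEntry, evalSV_xrowVec P hP]

/-- Row check with the fast builder. [folklore] -/
def bmatRowOKFast (P : NatPairList) (rep : ℕ) (cols : List SVec) (row : List ℤ) : Bool :=
  let xr := xrowVec P rep
  allPairs (fun b col => decide (b = (col.map fun e => e.2 * evalSV xr e.1).sum)) row cols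

/-- Semantics of the fast row check (same conclusion as `bmatRowOK_spec`). [folklore] -/
theorem bmatRowOKFast_spec {P : NatPairList} (hP : ∀ p ∈ P, p.1 ≠ p.2.1) {rep : ℕ} {cols : List SVec} {row : List ℤ}
    (h : bmatRowOKFast P rep cols row = true) :
    row.length = cols.length ∧ ∀ l < cols.length, row.getD l 0 = bmatEntry P rep (cols.getD l []) := by
  obtain ⟨hlen, hall⟩ := allPairs_spec _ row cols h
  refine ⟨hlen, fun l hl => ?_⟩
  have := hall l hl
  simp only [decide_eq_true_eq] at this
  rw [this, ← bmatEntryFast_eq P hP]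
  rfl

end FastRow

end Summit.HubbardSuperconductivity.HubbardLadder.ClusterCut
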